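import Summits.BirchSwinnertonDyer.BirchSwinnertonDyer.Theorems.SignedLowerHalvesSmallImageLowerHalfBothSignsRttJunctionShaRhoFrame
import Literature.NumberTheory.GaloisCohomology.ShaRestrictedShapiroLayer
import Literature.NumberTheory.GaloisCohomology.ArchimedeanInvariantMap
import Literature.AlgebraicGeometry.Frobenioids.PadicKummerDef22SchemaClosures
import HarnessLib

/-!
# Route `SignedLowerHalves`, crux L `SmallImageLowerHalfBothSigns` (stmt-BirchSwinnertonDyer-23599), line `rtt_w3` v31 — stub S3α′ (`stub_junctionShaPT_ns`),
# brick α5′-0 (dictionary): honda's levelwise `Ш²`-condition IS membership in the tree's Poitou–Tate layer currency `ShaLayer.layerShaRestricted`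

INPUTS hand `bsd-inputs-honda-p1` g28 under LEAD `cruxlead-stmt-BirchSwinnertonDyer-23599` g14 (cell `bsd-ssimc`); helper `--supports stmt-BirchSwinnertonDyer-23599`. THEOREMS ONLY.

WHAT. The `π`-half α5′ of S3α′ needs Poitou–Tate duality at the layers `(K_n, X_k)`; the tree's engine (`poitouTate_shaRestricted_tateDual_natural_at`, a THEOREM for totally complex `K`:
`EisensteinPrimesPoitouTateShaNaturalAtTC.forall_poitouTate_shaRestricted_tateDual_natural_at_of_isTotallyComplex`) speaks the currency `shaRestricted (ρ.coind U_n) P 2 ≃+ ShaLayer.layerShaRestricted P ρ U_n 2`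
(`ShaLayer.shaRestrictedCoindLayerEquiv_two`). This file identifies honda's side with that currency, for `ρ = muTwistO S θ′ k` (so that `ShaLayer.layerShaRestricted P (muTwistO S θ′ k) (U_n) 2` is
LITERALLY an additive subgroup of honda's layer group `cycLayerCohO S κ θ′ P n k 2 = H²((U_n)_P, X_k)` — one ambient representation, no transport):
* `layerConj_toUnramifiedQuot` — `ShaLayer.layerConj … (π δ) = cycLayerConjO … δ` (`rfl`);
* `comap_localizationHom_imGS_eq` — the layer's local group `φ_w⁻¹ (U_n)_P ≤ Γ_{K_w}` IS -w3's `U_{n,w} = res_w⁻¹ U_n` (`N_P ≤ U_n`);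
* ★ `layerLocalization_inr_eq_zero_iff` — at a finite place `w`: `ShaLayer.layerLocalization … (Sum.inr w) 2 x = 0 ↔ loc²_{n,w} x = 0` (honda's and -w3's `ContinuousCohomology.map (locLayerHom κ P w n) (locLayerMod …) 2`; the two
  restrictions differ by the tautological isomorphism of the two equal subgroups, `map_comp_apply_of`);
* ★ `layerLocalization_inl_two_eq_zero` — at an infinite place of a totally complex `K` the layer localisation vanishes (`Γ_{K_w} = 1`, `H²(1, ·) = 0`);
* ★★★ `mem_layerShaRestricted_iff_forall_loc` — for `K` totally complex and `N_P ≤ U_n`: `x ∈ ShaLayer.layerShaRestricted P (muTwistO S θ′ k) (U_n) 2 ↔ ∀ w ∈ P, ∀ δ, loc²_{n,w}(conj_δ x) = 0`, and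
  `… ↔ ∀ w ∈ P, semilocNKq S κ θ′ P w 2 n k x = 0`;
* ★★★ `exists_rhoTwo_finite_of_frame_sha` — the `ρ`-half of S3α′ (part 9) with its kernel read in PT currency: `ρ b = 0 ↔ ∀ n k, I.proj n k b ∈ ShaLayer.layerShaRestricted P (muTwistO S θ′ k) (U_n) 2`.
So α5′ = «every compatible family of layer-`Ш²` classes comes from `π`», with the tree's perfect, natural PT pairings available on each layer.
HONEST FRAMING: a dictionary; α5′ itself (the `π`-half), S3α′, crux L and BSD are NOT proved here and remain OPEN; BSD is proved for NO curve.
References: [MilneADT2006] I §4 (p. 56), Thm. 4.10 (a); [Harari2020] §17.2–17.3; [NeukirchSchmidtWingberg2008] (1.5.6)–(1.5.7), (8.6.3); [SerreGaloisCohomology1997] I §2.3, II §6.3.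
-/

set_option autoImplicit false
set_option linter.dupNamespace false -- D-0017: single-problem summit, the namespace repeats the problem name by design
noncomputable section

open scoped Classical
open NumberField IsDedekindDomain Field Function CategoryTheory

namespace Summit.BirchSwinnertonDyer.BirchSwinnertonDyer.Theorems.SmallImageRttJunctionSha

open Literature.NumberTheory.EllipticCurves Literature.NumberTheory.GaloisRepresentations Literature.NumberTheory.GaloisCohomology
  Literature.NumberTheory.ComplexMultiplication.EllipticUnits Literature.NumberTheory.ComplexMultiplication.EllipticUnits.JohnsonLeungKings2011
  Summit.BirchSwinnertonDyer.BirchSwinnertonDyer.Theorems.SmallImageRttD2J1 Summit.BirchSwinnertonDyer.BirchSwinnertonDyer.Theorems.SmallImageRttD2Seq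

/-! ## §1 Conjugation and the local groups -/

section Dict

variable {K : Type} [Field K] [NumberField K] {p : ℕ} [Fact p.Prime] (S : Set (PadicAlgCl p))
  (κ : ZpExtension K p) (θ' : absoluteGaloisGroup K →ₜ* (padicCoeffIntegers S)ˣ) (P : Set (HeightOneSpectrum (𝓞 K))) (w : HeightOneSpectrum (𝓞 K))

omit [NumberField K] in
/-- The tree's `layerConj` at `π δ` IS honda's `cycLayerConjO … δ` (one ambient representation `X_k = (𝒪 ⊗ μ_{p^k} ⊗ θ′)^{N_P}` of `G_P`). [cite: SerreLocalFields1979, VII §5] -/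
theorem layerConj_toUnramifiedQuot (n k i : ℕ) (δ : absoluteGaloisGroup K) (x : cycLayerCohO S κ θ' P n k i) :
    ShaLayer.layerConj P (muTwistO S θ' k) (κ.layerSubgroup n) (toUnramifiedQuot K P δ) i x = cycLayerConjO S κ θ' P n k i δ x := rfl

/-- **The layer's local group at `w` is `U_{n,w}`**: `φ_w⁻¹((U_n)_P) = res_w⁻¹(U_n)` inside `Γ_{K_w}` when `N_P ≤ U_n` (`φ_w = π ∘ res_w`). [cite: Harari2020, §17.2 (p. 290)]
[cite: NeukirchSchmidtWingberg2008, I §5 (1.5.6)] -/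
theorem comap_localizationHom_imGS_eq (hNP : ∀ n, ramificationSubgroup K P ≤ κ.layerSubgroup n) (n : ℕ) :
    ((imGS P (κ.layerSubgroup n)).comap
        (RestrictedExt.localizationHom K P (Sum.inr w) : absoluteGaloisGroup (Place.Completion (K := K) (Sum.inr w)) →* GaloisGroupUnramifiedOutside K P)) =
      localSubgroupOfEmb (κ.layerSubgroup n) (closureEmb (K := K) (w.adicCompletion K)) := by
  ext τ
  constructor
  · intro h
    have h' : toUnramifiedQuot K P (resGalOfEmb (closureEmb (K := K) (w.adicCompletion K)) τ) ∈ imGS P (κ.layerSubgroup n) := Subgroup.mem_comap.mp h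
    exact (mem_localSubgroupOfEmb_iff _ _ τ).mpr (SmallImageRttD2J2Delta.mem_of_toUnramifiedQuot_mem_imGS P (hNP n) h')
  · intro h
    exact Subgroup.mem_comap.mpr (Subgroup.mem_map_of_mem _ ((mem_localSubgroupOfEmb_iff _ _ τ).mp h))

/-- ★ **AT A FINITE PLACE the layer localisation of the tree and honda's `loc²_{n,w}` vanish together**: both are restrictions from `(U_n)_P` to the same subgroup `U_{n,w}` of `Γ_{K_w}`
(written once as `φ_w⁻¹ (U_n)_P`, once as `res_w⁻¹ U_n`) with the identity on coefficients; they differ by the tautological isomorphism. [cite: Harari2020, §17.2 (p. 290)]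
[cite: NeukirchSchmidtWingberg2008, I §5 (1.5.6)–(1.5.7)] -/
theorem layerLocalization_inr_eq_zero_iff (hNP : ∀ n, ramificationSubgroup K P ≤ κ.layerSubgroup n) (n k : ℕ) (x : cycLayerCohO S κ θ' P n k 2) :
    ShaLayer.layerLocalization P (muTwistO S θ' k) (κ.layerSubgroup n) (Sum.inr w) 2 x = 0 ↔
      ContinuousCohomology.map (locLayerHom κ P w n) (locLayerMod S κ θ' P w n k) 2 x = 0 := by
  have hAB := comap_localizationHom_imGS_eq κ P w hNP n
  -- the two tautological inclusions between the (equal) local groups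
  let ι₁ : ↥(localSubgroupOfEmb (κ.layerSubgroup n) (closureEmb (K := K) (w.adicCompletion K))) →ₜ*
      ↥((imGS P (κ.layerSubgroup n)).comap
        (RestrictedExt.localizationHom K P (Sum.inr w) : absoluteGaloisGroup (Place.Completion (K := K) (Sum.inr w)) →* GaloisGroupUnramifiedOutside K P)) :=
    { toFun := fun τ ↦ ⟨τ.1, (SetLike.ext_iff.mp hAB τ.1).mpr τ.2⟩
      map_one' := rfl
      map_mul' := fun _ _ ↦ rfl
      continuous_toFun := continuous_subtype_val.subtype_mk _ }
  let ι₂ : ↥((imGS P (κ.layerSubgroup n)).comap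
        (RestrictedExt.localizationHom K P (Sum.inr w) : absoluteGaloisGroup (Place.Completion (K := K) (Sum.inr w)) →* GaloisGroupUnramifiedOutside K P)) →ₜ*
      ↥(localSubgroupOfEmb (κ.layerSubgroup n) (closureEmb (K := K) (w.adicCompletion K))) :=
    { toFun := fun τ ↦ ⟨τ.1, (SetLike.ext_iff.mp hAB τ.1).mp τ.2⟩
      map_one' := rfl
      map_mul' := fun _ _ ↦ rfl
      continuous_toFun := continuous_subtype_val.subtype_mk _ }
  -- the identity coefficient maps
  let g₁ : TopRep.res (ι₁ : _ →* _)
        (subgroupRep (TopRep.res (RestrictedExt.localizationHom K P (Sum.inr w) : absoluteGaloisGroup (Place.Completion (K := K) (Sum.inr w)) →* GaloisGroupUnramifiedOutside K P)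
          (coeffGSO S P θ' k).toTopRep)
          ((imGS P (κ.layerSubgroup n)).comap
            (RestrictedExt.localizationHom K P (Sum.inr w) : absoluteGaloisGroup (Place.Completion (K := K) (Sum.inr w)) →* GaloisGroupUnramifiedOutside K P))) ⟶
      subgroupRep (locCoeffRep S θ' P w k).toTopRep (localSubgroupOfEmb (κ.layerSubgroup n) (closureEmb (K := K) (w.adicCompletion K))) :=
    TopRep.ofHom ⟨ContinuousLinearMap.id ℤ _, fun _ ↦ rfl⟩
  let g₂ : TopRep.res (ι₂ : _ →* _) (subgroupRep (locCoeffRep S θ' P w k).toTopRep (localSubgroupOfEmb (κ.layerSubgroup n) (closureEmb (K := K) (w.adicCompletion K)))) ⟶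
      subgroupRep (TopRep.res (RestrictedExt.localizationHom K P (Sum.inr w) : absoluteGaloisGroup (Place.Completion (K := K) (Sum.inr w)) →* GaloisGroupUnramifiedOutside K P)
          (coeffGSO S P θ' k).toTopRep)
        ((imGS P (κ.layerSubgroup n)).comap
          (RestrictedExt.localizationHom K P (Sum.inr w) : absoluteGaloisGroup (Place.Completion (K := K) (Sum.inr w)) →* GaloisGroupUnramifiedOutside K P)) :=
    TopRep.ofHom ⟨ContinuousLinearMap.id ℤ _, fun _ ↦ rfl⟩
  have h1 : ContinuousCohomology.map (locLayerHom κ P w n) (locLayerMod S κ θ' P w n k) 2 x =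
      ContinuousCohomology.map ι₁ g₁ 2
        (ContinuousCohomology.map (comapSubtypeHom (imGS P (κ.layerSubgroup n)) (RestrictedExt.localizationHom K P (Sum.inr w)))
          (comapCoeffHom (coeffGSO S P θ' k).toTopRep (imGS P (κ.layerSubgroup n)) (RestrictedExt.localizationHom K P (Sum.inr w))) 2 x) :=
    map_comp_apply_of (comapSubtypeHom (imGS P (κ.layerSubgroup n)) (RestrictedExt.localizationHom K P (Sum.inr w))) ι₁ (locLayerHom κ P w n)
      (fun _ ↦ rfl) (comapCoeffHom (coeffGSO S P θ' k).toTopRep (imGS P (κ.layerSubgroup n)) (RestrictedExt.localizationHom K P (Sum.inr w))) g₁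
      (locLayerMod S κ θ' P w n k) (fun _ ↦ rfl) 2 x
  have h2 : ContinuousCohomology.map (comapSubtypeHom (imGS P (κ.layerSubgroup n)) (RestrictedExt.localizationHom K P (Sum.inr w)))
        (comapCoeffHom (coeffGSO S P θ' k).toTopRep (imGS P (κ.layerSubgroup n)) (RestrictedExt.localizationHom K P (Sum.inr w))) 2 x =
      ContinuousCohomology.map ι₂ g₂ 2 (ContinuousCohomology.map (locLayerHom κ P w n) (locLayerMod S κ θ' P w n k) 2 x) :=
    map_comp_apply_of (locLayerHom κ P w n) ι₂ (comapSubtypeHom (imGS P (κ.layerSubgroup n)) (RestrictedExt.localizationHom K P (Sum.inr w)))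
      (fun _ ↦ rfl) (locLayerMod S κ θ' P w n k) g₂
      (comapCoeffHom (coeffGSO S P θ' k).toTopRep (imGS P (κ.layerSubgroup n)) (RestrictedExt.localizationHom K P (Sum.inr w))) (fun _ ↦ rfl) 2 x
  change ContinuousCohomology.map (comapSubtypeHom (imGS P (κ.layerSubgroup n)) (RestrictedExt.localizationHom K P (Sum.inr w)))
      (comapCoeffHom (coeffGSO S P θ' k).toTopRep (imGS P (κ.layerSubgroup n)) (RestrictedExt.localizationHom K P (Sum.inr w))) 2 x = 0 ↔ _
  constructor
  · intro h0
    rw [h1, h0, map_zero]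
  · intro h0
    rw [h2, h0, map_zero]

/-- ★ **AT AN INFINITE PLACE of a totally complex `K` the layer localisation vanishes in degree `2`**: `K_w ≅ ℂ`, so `Γ_{K_w} = 1` (tree `eq_one_absoluteGaloisGroup_of_isComplex`) and `H²(1, ·) = 0`
(tree `Kummer.subsingleton_continuousCohomology_two_of_subsingleton_group`). [cite: SerreGaloisCohomology1997, I §2.3, II §6.3] [cite: MilneADT2006, I Thm. 4.10 (a)] -/
theorem layerLocalization_inl_two_eq_zero [IsTotallyComplex K] (n k : ℕ) (v : InfinitePlace K) (x : cycLayerCohO S κ θ' P n k 2) :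
    ShaLayer.layerLocalization P (muTwistO S θ' k) (κ.layerSubgroup n) (Sum.inl v) 2 x = 0 := by
  haveI : Subsingleton (absoluteGaloisGroup (Place.Completion (K := K) (Sum.inl v))) :=
    ⟨fun a b ↦ by rw [eq_one_absoluteGaloisGroup_of_isComplex (IsTotallyComplex.isComplex v) a, eq_one_absoluteGaloisGroup_of_isComplex (IsTotallyComplex.isComplex v) b]⟩
  haveI : CompactSpace ↥((imGS P (κ.layerSubgroup n)).comap
      (RestrictedExt.localizationHom K P (Sum.inl v) : absoluteGaloisGroup (Place.Completion (K := K) (Sum.inl v)) →* GaloisGroupUnramifiedOutside K P)) :=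
    Finite.compactSpace
  have h := Literature.AlgebraicGeometry.Frobenioids.Kummer.subsingleton_continuousCohomology_two_of_subsingleton_group
    (subgroupRep (TopRep.res (RestrictedExt.localizationHom K P (Sum.inl v) : absoluteGaloisGroup (Place.Completion (K := K) (Sum.inl v)) →* GaloisGroupUnramifiedOutside K P)
      (coeffGSO S P θ' k).toTopRep)
      ((imGS P (κ.layerSubgroup n)).comap
        (RestrictedExt.localizationHom K P (Sum.inl v) : absoluteGaloisGroup (Place.Completion (K := K) (Sum.inl v)) →* GaloisGroupUnramifiedOutside K P)))
  exact @Subsingleton.elim _ h _ _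

/-- ★★★ **HONDA'S LEVELWISE `Ш²`-CONDITION IS MEMBERSHIP IN THE TREE'S `ShaLayer.layerShaRestricted`** (K totally complex, `N_P ≤ U_n`): for `x ∈ H²((U_n)_P, X_k) = cycLayerCohO … n k 2`,
`x ∈ Ш²_P(K_n, X_k)` (the layer currency of the tree's Poitou–Tate files) iff `loc²_{n,w}(conj_δ x) = 0` for every `w ∈ P` and every `δ ∈ Γ_K` (all places of `K_n` above `P`).
[cite: MilneADT2006, I §4 (p. 56)] [cite: Harari2020, §17.3 (p. 294)] [cite: NeukirchSchmidtWingberg2008, I §5 (1.5.6)–(1.5.7)] -/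
theorem mem_layerShaRestricted_iff_forall_loc [IsTotallyComplex K] (hNP : ∀ n, ramificationSubgroup K P ≤ κ.layerSubgroup n) (n k : ℕ)
    (x : cycLayerCohO S κ θ' P n k 2) :
    x ∈ ShaLayer.layerShaRestricted P (muTwistO S θ' k) (κ.layerSubgroup n) 2 ↔
      ∀ w ∈ P, ∀ δ : absoluteGaloisGroup K,
        ContinuousCohomology.map (locLayerHom κ P w n) (locLayerMod S κ θ' P w n k) 2 (cycLayerConjO S κ θ' P n k 2 δ x) = 0 := by
  refine (ShaLayer.mem_layerShaRestricted_iff P (muTwistO S θ' k) (κ.layerSubgroup n) 2 x).trans ?_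
  constructor
  · rintro ⟨-, h⟩ w hw δ
    rw [← layerConj_toUnramifiedQuot, ← layerLocalization_inr_eq_zero_iff S κ θ' P w hNP]
    exact h w hw _
  · intro h
    refine ⟨fun v σ ↦ layerLocalization_inl_two_eq_zero S κ θ' P n k v _, fun w hw σ ↦ ?_⟩
    obtain ⟨δ, rfl⟩ := toUnramifiedQuot_surjective K P σ
    rw [layerConj_toUnramifiedQuot, layerLocalization_inr_eq_zero_iff S κ θ' P w hNP]
    exact h w hw δ

/-- ★★ **The same, semilocally**: `x ∈ Ш²_P(K_n, X_k) ↔ sloc²_{w,n,k} x = 0` for every `w ∈ P` (honda's `semilocNKq … w 2 n k`, part 1's `semilocNK₂_eq_zero_iff`).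
[cite: NeukirchSchmidtWingberg2008, I §5 (1.5.6)–(1.5.7), I §6 (1.6.4)–(1.6.5)] -/
theorem mem_layerShaRestricted_iff_forall_semilocNKq [IsTotallyComplex K] (hNP : ∀ n, ramificationSubgroup K P ≤ κ.layerSubgroup n) (n k : ℕ)
    (x : cycLayerCohO S κ θ' P n k 2) :
    x ∈ ShaLayer.layerShaRestricted P (muTwistO S θ' k) (κ.layerSubgroup n) 2 ↔ ∀ w ∈ P, semilocNKq S κ θ' P w 2 n k x = 0 := by
  rw [mem_layerShaRestricted_iff_forall_loc S κ θ' P hNP]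
  exact forall₂_congr fun w _ ↦ (semilocNK₂_eq_zero_iff S κ θ' P w n k x).symm

end Dict

/-! ## §2 The `ρ`-half of S3α′ with its kernel in Poitou–Tate currency -/

section Frame

variable {K : Type} [Field K] [NumberField K] {p : ℕ} [hp : Fact p.Prime] (hp2 : p ≠ 2) {κ : ZpExtension ℚ p} (hK2 : Module.finrank ℚ K = 2)

/-- ★★★ **THE `ρ`-HALF OF S3α′, KERNEL IN PT CURRENCY**: as part 9's `exists_rhoTwo_finite_of_frame` (stub binders; `K` totally complex — prefix `htc`), with `ρ b = 0 ↔ ∀ n k, I.proj n k b ∈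
ShaLayer.layerShaRestricted (supp p𝔣) (muTwistO S θ′ k) (U_n) 2` — the layer `Ш²` on which the tree's natural Poitou–Tate pairing with `Ш¹` of the Cartier dual is perfect
(`ShaLayer.shaRestrictedCoindLayerEquiv_two` + `forall_poitouTate_shaRestricted_tateDual_natural_at_of_isTotallyComplex`). What α5′ must supply: `π : Y′ →ₗ[Λ] I.H` reaching every `b` all of whose projections
are layer-`Ш²` classes. [cite: MilneADT2006, I Thm. 4.10 (a)] [cite: NeukirchSchmidtWingberg2008, (8.6.3), (8.6.10)] [cite: Serre1972, §1.11 Prop. 12 c)] -/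
theorem exists_rhoTwo_finite_of_frame_sha [IsTotallyComplex K] (S : Set (PadicAlgCl p)) (hS : 0 < Module.finrank ℚ_[p] (padicCoeffField S))
    (hκ : κ.IsCyclotomic) {γ : absoluteGaloisGroup ℚ} (hγ : κ.IsTopGenerator γ) (hcv : IsCyclotomicVariable p γ)
    (θ : FramedGaloisRep K (padicCoeffIntegers S) 1)
    (W : WeierstrassCurve ℚ) [W.IsElliptic] [W.IsGloballyMinimal] (hgood : W.HasGoodReductionAtPrime p) (hap : (p : ℤ) ∣ W.frobeniusTrace p)
    (j : (W.baseChange K).geomPrimaryTorsion p →+ GreenbergSelmer.Cofree θ (padicCoeffField S))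
    (hj : ∀ v : HeightOneSpectrum (𝓞 K), ((p : ℕ) : 𝓞 K) ∈ v.asIdeal →
      ∀ (δ : absoluteGaloisGroup (v.adicCompletion K)) (t : (W.baseChange K).geomPrimaryTorsion p),
        j (resGalOfEmb (closureEmb (K := K) (v.adicCompletion K)) δ • t) = resGalOfEmb (closureEmb (K := K) (v.adicCompletion K)) δ • j t)
    (hjspan : Submodule.span (padicCoeffIntegers S) (Set.range j) = ⊤)
    (vp : HeightOneSpectrum (𝓞 K)) (hv : vp.asIdeal = Ideal.span {((p : ℕ) : 𝓞 K)}) (hnd : ¬ (p : ℤ) ∣ NumberField.discr K)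
    (κ₂ : ZpExtension K p) (𝔣 : Ideal (𝓞 K)) (χ₀ θ' : absoluteGaloisGroup K →ₜ* (padicCoeffIntegers S)ˣ)
    (hθ'θ : ∀ g : absoluteGaloisGroup K, ((θ' g : (padicCoeffIntegers S)ˣ) : padicCoeffIntegers S) *
      ((θ g : GL (Fin 1) (padicCoeffIntegers S)) : Matrix (Fin 1) (Fin 1) (padicCoeffIntegers S)) 0 0 = 1)
    (hθfin : ∃ m : ℕ, 0 < m ∧ ∀ τ : absoluteGaloisGroup K, χ₀ τ ^ m = 1)
    (hker : ∀ τ ∈ ZpExtension.pairKer (κ.restrictOfFinrankEqTwo hp2 K hK2) κ₂, θ' τ = χ₀ τ)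
    (hR : ∀ w ∈ suppPF p 𝔣, ((p : ℕ) : 𝓞 K) ∉ w.asIdeal → ∃ 𝔓 ∈ w.primesAbove, ∃ τ ∈ 𝔓.inertia (absoluteGaloisGroup K), θ' τ ≠ 1)
    (h𝔣 : 𝔣 ≠ ⊥)
    (hNP : ∀ n, ramificationSubgroup K (suppPF p 𝔣) ≤ (κ.restrictOfFinrankEqTwo hp2 K hK2).layerSubgroup n)
    {γK : absoluteGaloisGroup K}
    (I : SmallImageRttD2J1.CycIwasawaCohomologyDataO S (κ.restrictOfFinrankEqTwo hp2 K hK2) γK θ' (suppPF p 𝔣) 2) :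
    letI := I.moduleIwasawa
    ∃ (Loc : Type) (_ : AddCommGroup Loc) (_ : Module (IwasawaAlgebra p) Loc) (_ : Finite Loc) (ρ : I.H →ₗ[IwasawaAlgebra p] Loc),
      ∀ b : I.H, ρ b = 0 ↔ ∀ n k : ℕ, I.proj n k b ∈ ShaLayer.layerShaRestricted (suppPF p 𝔣) (muTwistO S θ' k) ((κ.restrictOfFinrankEqTwo hp2 K hK2).layerSubgroup n) 2 := by
  obtain ⟨Loc, i1, i2, i3, ρ, hρ⟩ := exists_rhoTwo_finite_of_frame hp2 hK2 S hS hκ hγ hcv θ W hgood hap j hj hjspan vp hv hnd κ₂ 𝔣 χ₀ θ' hθ'θ hθfin hker hR h𝔣 hNP I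
  refine ⟨Loc, i1, i2, i3, ρ, fun b ↦ (hρ b).trans ⟨fun h n k ↦ ?_, fun h w hw n k δ ↦ ?_⟩⟩
  · exact (mem_layerShaRestricted_iff_forall_loc S (κ.restrictOfFinrankEqTwo hp2 K hK2) θ' (suppPF p 𝔣) hNP n k _).mpr (fun w hw δ ↦ h w hw n k δ)
  · exact (mem_layerShaRestricted_iff_forall_loc S (κ.restrictOfFinrankEqTwo hp2 K hK2) θ' (suppPF p 𝔣) hNP n k _).mp (h n k) w hw δ

end Frame

end Summit.BirchSwinnertonDyer.BirchSwinnertonDyer.Theorems.SmallImageRttJunctionSha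

end
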